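import Summits.KontsevichZagierPeriods.Zeta5Search.Barrier.ConeGammaCuspChamberCover

/-!
# ζ(5) search — BARRIER: THE WEIGHTS OF THE CUSP SLOPE ARE BOUNDED BY THE MEMBER COUNTS — the oriented bound

HONEST FRAMING (cell `pub-zeta5`): systematic search; no irrationality claim unless kernel-certified. MODEL objects
under Brown–Zudilin's (28)+(30) accounting ([BZ22] = arXiv:2210.03391; (28) observed, not proved); nothing here is a
statement about `ζ(5)`, any `γ` of record, the cone's supremum (C2 OPEN) or the VALUE / SIGN of the cusp slope or of
its weights at a named direction (DATA of the cell); S-E stays CONJECTURED; records in print UNMOVED. Prover P2 g30,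
item «THE JUNCTION VOTE IS A LOVÁSZ EXTENSION» (INBOX 2026-08-27), file (2) = P2 g29's successor menu (c).

* `exists_index_of_mem_bkpts` — every breakpoint is enumerated; **`card_member_junctions`** — form `k` is a MEMBER
  (`b·h_k(a) ∈ ℤ`) of exactly `T·h_k(a)` junctions `b` of the period `[0, T)` (the points `z/h_k`, `0 ≤ z < T·h_k`);
* **`cuspSlope_eq_intLinear_bounded`** — for EVERY displacement `δ`: `σ(δ') = Σ_k 𝒥_k φ_k(δ')/h_k(a)` on the closed
  chamber of a generic `δ₀ ∋ δ` with `𝒥 ∈ ℤ²⁸`, `Σ𝒥 = 0`, **`0 ≤ 𝒥_k ≤ T·h_k(a)` for `k ∈ F` and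
  `−T·h_k(a) ≤ 𝒥_k ≤ 0` for `k ∉ F`** (on a generic chamber every junction weight is a simple flip, `0/+1` on `F`,
  `−1/0` off `F`, non-zero only at junctions where `k` is a member — P2 g29 (i), (iii));
* **`cuspSlope_le_oriented`**, **`oriented_le_cuspSlope`** — the ORIENTED FIRST-ORDER BOUND
  `−T·(Σ_{k∈F} φ_k(δ)⁻ + Σ_{k∉F} φ_k(δ)⁺) ≤ σ(δ) ≤ T·(Σ_{k∈F} φ_k(δ)⁺ + Σ_{k∉F} φ_k(δ)⁻)`: to first order only `F`-forms
  moving UP and `F^c`-forms moving DOWN can raise the saving (the cusp-slope form of P2 g26's wall orientation; the two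
  halves add up to P2 g29's `|σ(δ)| ≤ T·Σ_k |φ_k(δ)|`).
DESK (DATA, `HOME/pub-zeta5-p2/g30/alg/modcensus.py` (C5)): member counts `= T·h_k` for all 28 forms at record/41,
flag/60, argmax-120, t*/480; `Σ_{k∈F}` = 446 / 320 / 644 / 2532. NOT here: the weights at any named direction.
-/

noncomputable section

open Set MeasureTheory
open scoped Topology

namespace Summit.KontsevichZagierPeriods.Zeta5Search.Barrier.ConeGamma

/-! ### Member junction counts -/

/-- Every breakpoint is `bkpt a T m` for some index `m`. -/
theorem exists_index_of_mem_bkpts {a : Dir} {T x : ℝ} (hx : x ∈ bkpts a T) :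
    ∃ m, m < (bkpts a T).card ∧ bkpt a T m = x := by
  have hx' : x ∈ Set.range ((bkpts a T).orderEmbOfFin rfl) := by rw [Finset.range_orderEmbOfFin]; exact hx
  obtain ⟨i, hi⟩ := hx'
  exact ⟨i.val, i.isLt, by rw [bkpt_eq i.isLt]; exact hi⟩

open scoped Classical in
/-- **Form `k` is a member of exactly `T·h_k(a)` junctions of one period.** For all forms positive, `T > 0` with
`T·h_k(a) ∈ ℤ`: the junctions `b_m`, `m + 1 < #bkpts` (i.e. the breakpoints in `[0, T)`), at which `b_m·h_k(a) ∈ ℤ`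
are exactly the points `z/h_k`, `0 ≤ z < T·h_k` — there are `T·h_k(a)` of them. -/
theorem card_member_junctions {a : Dir} (hpos : ∀ k, 0 < h28 a k) {T : ℝ} (hT : 0 < T) (k : Fin 28)
    (hper : ∃ z : ℤ, T * h28 a k = z) :
    ((((Finset.range ((bkpts a T).card - 1)).filter fun m => ∃ z : ℤ, bkpt a T m * h28 a k = z).card : ℕ) : ℝ) =
      T * h28 a k := by
  classical
  have hk := hpos k
  have hcard := two_le_card_bkpts a hT
  obtain ⟨z, hz⟩ := hper
  have hz0 : 0 < z := by
    have : (0 : ℝ) < z := by rw [← hz]; exact mul_pos hT hk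
    exact_mod_cast this
  obtain ⟨nk, hnk⟩ : ∃ nk : ℕ, (nk : ℤ) = z := ⟨z.toNat, Int.toNat_of_nonneg hz0.le⟩
  have hnkR : (nk : ℝ) = T * h28 a k := by rw [hz]; exact_mod_cast hnk
  obtain ⟨I, hI⟩ : ∃ I : Finset ℕ,
      I = (Finset.range ((bkpts a T).card - 1)).filter fun m => ∃ z : ℤ, bkpt a T m * h28 a k = z := ⟨_, rfl⟩
  rw [← hI]
  have hmemI : ∀ m, m ∈ I ↔ m < (bkpts a T).card - 1 ∧ ∃ z : ℤ, bkpt a T m * h28 a k = z := fun m => by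
    rw [hI, Finset.mem_filter, Finset.mem_range]
  -- the member junctions, as points, are the `j/h_k`, `j < nk`
  have hIV : I.image (bkpt a T) = (Finset.range nk).image fun j : ℕ => (j : ℝ) / h28 a k := by
    ext x
    simp only [Finset.mem_image, Finset.mem_range, hmemI]
    constructor
    · rintro ⟨m, ⟨hm, w, hw⟩, rfl⟩
      have hb0 : 0 ≤ bkpt a T m := (mem_bkpts_bounds (bkpt_mem (by omega))).1
      have hbT : bkpt a T m < T := by
        have h := bkpt_strictMono (a := a) (T := T) (m := m) (m' := (bkpts a T).card - 1) (by omega) (by omega)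
        rwa [bkpt_last a hT] at h
      have hw0 : 0 ≤ w := by
        have : (0 : ℝ) ≤ w := by rw [← hw]; exact mul_nonneg hb0 hk.le
        exact_mod_cast this
      have hwn : w < nk := by
        have : (w : ℝ) < nk := by
          rw [← hw, hnkR]; exact mul_lt_mul_of_pos_right hbT hk
        exact_mod_cast this
      refine ⟨w.toNat, by omega, ?_⟩
      have : ((w.toNat : ℕ) : ℝ) = w := by exact_mod_cast Int.toNat_of_nonneg hw0
      rw [this, ← hw, mul_div_cancel_right₀ _ hk.ne']
    · rintro ⟨j, hj, rfl⟩
      have hjT : (j : ℝ) / h28 a k < T := by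
        rw [div_lt_iff₀ hk, ← hnkR]; exact_mod_cast hj
      have hmem : ((j : ℤ) : ℝ) / h28 a k ∈ bkpts a T :=
        div_mem_bkpts hk (by positivity) (by push_cast; exact hjT.le)
      push_cast at hmem
      obtain ⟨m, hm, hmx⟩ := exists_index_of_mem_bkpts hmem
      refine ⟨m, ⟨?_, (j : ℤ), ?_⟩, hmx⟩
      · by_contra hge
        have hm' : m = (bkpts a T).card - 1 := by omega
        rw [hm', bkpt_last a hT] at hmx
        linarith
      · rw [hmx, div_mul_cancel₀ _ hk.ne']; push_cast; ring
  have hinj : Set.InjOn (bkpt a T) I := by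
    intro m hm m' hm' h
    rw [Finset.mem_coe, hmemI] at hm hm'
    by_contra hne
    rcases lt_or_gt_of_ne hne with hlt | hlt
    · exact absurd h (bkpt_strictMono hlt (by omega)).ne
    · exact absurd h.symm (bkpt_strictMono hlt (by omega)).ne
  have hinj' : Function.Injective fun j : ℕ => (j : ℝ) / h28 a k := by
    intro j j' h
    have : (j : ℝ) = j' := by
      have := congrArg (· * h28 a k) h
      simpa only [div_mul_cancel₀ _ hk.ne'] using this
    exact_mod_cast this
  rw [← hnkR, ← Finset.card_image_of_injOn hinj, hIV, Finset.card_image_of_injective _ hinj', Finset.card_range]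

/-! ### Bounded oriented weights for every displacement -/

/-- **THE WEIGHTS ARE BOUNDED BY THE MEMBER COUNTS.** For all 28 forms of `a` positive, `T > 0` a period and EVERY
displacement `δ`: there are a generic `δ₀` refining `δ` and integers `𝒥_k` with `Σ_k 𝒥_k = 0`,
`0 ≤ 𝒥_k ≤ T·h_k(a)` (`k ∈ F`), `−T·h_k(a) ≤ 𝒥_k ≤ 0` (`k ∉ F`), such that `cuspSlope a T δ' = Σ_k 𝒥_k·φ_k(δ')/h_k(a)`
for every `δ'` refined by `δ₀`, in particular at `δ`. (Per junction the generic weight is a simple flip supported on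
the members — P2 g29's `germ_pair_eq_intLinear_of_refines` (i), (iii) with `S = {k}` — and `k` is a member of
`T·h_k(a)` junctions, `card_member_junctions`.) -/
theorem cuspSlope_eq_intLinear_bounded {a : Dir} (hpos : ∀ k, 0 < h28 a k) {T : ℝ} (hT : 0 < T)
    (hper : ∀ k : Fin 28, ∃ z : ℤ, T * h28 a k = z) (δ : Fin 8 → ℝ) :
    ∃ δ₀ : Fin 8 → ℝ, (∀ k l : Fin 28, k ≠ l → phiForm δ₀ k / h28 a k ≠ phiForm δ₀ l / h28 a l) ∧
      (∀ k l : Fin 28, phiForm δ k / h28 a k < phiForm δ l / h28 a l →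
        phiForm δ₀ k / h28 a k < phiForm δ₀ l / h28 a l) ∧
      ∃ 𝒥 : Fin 28 → ℤ, ∑ k, 𝒥 k = 0 ∧
        (∀ k, k ∈ FIdx → 0 ≤ 𝒥 k ∧ (𝒥 k : ℝ) ≤ T * h28 a k) ∧
        (∀ k, k ∉ FIdx → -(T * h28 a k) ≤ (𝒥 k : ℝ) ∧ 𝒥 k ≤ 0) ∧
        (∀ δ' : Fin 8 → ℝ, (∀ k l : Fin 28, phiForm δ' k / h28 a k < phiForm δ' l / h28 a l →
            phiForm δ₀ k / h28 a k < phiForm δ₀ l / h28 a l) →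
          cuspSlope a T δ' = ∑ k, (𝒥 k : ℝ) * (phiForm δ' k / h28 a k)) ∧
        cuspSlope a T δ = ∑ k, (𝒥 k : ℝ) * (phiForm δ k / h28 a k) := by
  classical
  obtain ⟨δ₀, hgen, href⟩ := exists_generic_refines hpos δ
  -- singleton tie classes on a generic chamber
  have hS : ∀ b (k l : Fin 28), (∃ z : ℤ, b * h28 a l = z) → phiForm δ₀ l / h28 a l = phiForm δ₀ k / h28 a k →
      l ∈ ({k} : Finset (Fin 28)) := fun b k l _ h => by
    rw [Finset.mem_singleton]
    by_contra hne
    exact hgen l k hne h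
  -- per junction: a simple flip supported on the members, with the chamber formula
  have key : ∀ m : ℕ, ∃ J : Fin 28 → ℤ, m + 1 < (bkpts a T).card →
      (∀ k, ((∀ z : ℤ, bkpt a T m * h28 a k ≠ z) → J k = 0) ∧
        (k ∈ FIdx → 0 ≤ J k ∧ J k ≤ 1) ∧ (k ∉ FIdx → -1 ≤ J k ∧ J k ≤ 0)) ∧
      ∀ δ' : Fin 8 → ℝ, (∀ k l : Fin 28, phiForm δ' k / h28 a k < phiForm δ' l / h28 a l →
          phiForm δ₀ k / h28 a k < phiForm δ₀ l / h28 a l) →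
        ∀ η, 0 < η → η * clusterBound a δ' < 1 → η * clusterBound a δ' < wallDist a T →
          germR a δ' η (bkpt a T m) + germL a δ' η (bkpt a T m) = ∑ k, (J k : ℝ) * (phiForm δ' k / h28 a k) := by
    intro m
    by_cases hm : m + 1 < (bkpts a T).card
    · obtain ⟨J, hsupp, -, hbd, hJ⟩ :=
        germ_pair_eq_intLinear_of_refines hpos hT (bkpt_mem (by omega : m < (bkpts a T).card)) δ₀
      refine ⟨J, fun _ => ⟨fun k => ⟨hsupp k, fun hk => ?_, fun hk => ?_⟩,
        fun δ' href' η hη h1 h2 => hJ δ' (fun k l _ _ h => href' k l h) η hη h1 h2⟩⟩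
      · have h := hbd k {k} (hS _ k)
        have e1 : (({k} : Finset (Fin 28)) ∩ FIdxᶜ) = ∅ := Finset.eq_empty_of_forall_notMem fun l hl => by
          rw [Finset.mem_inter, Finset.mem_singleton, Finset.mem_compl] at hl; exact hl.2 (hl.1 ▸ hk)
        have e2 : (({k} : Finset (Fin 28)) ∩ FIdx).card ≤ 1 :=
          (Finset.card_le_card Finset.inter_subset_left).trans (Finset.card_singleton k).le
        rw [e1, Finset.card_empty] at h
        exact ⟨by simpa using h.1, h.2.trans (by exact_mod_cast e2)⟩
      · have h := hbd k {k} (hS _ k)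
        have e1 : (({k} : Finset (Fin 28)) ∩ FIdx) = ∅ := Finset.eq_empty_of_forall_notMem fun l hl => by
          rw [Finset.mem_inter, Finset.mem_singleton] at hl; exact hk (hl.1 ▸ hl.2)
        have e2 : (({k} : Finset (Fin 28)) ∩ FIdxᶜ).card ≤ 1 :=
          (Finset.card_le_card Finset.inter_subset_left).trans (Finset.card_singleton k).le
        rw [e1, Finset.card_empty] at h
        refine ⟨?_, by simpa using h.2⟩
        have : -(1 : ℤ) ≤ -((({k} : Finset (Fin 28)) ∩ FIdxᶜ).card : ℤ) := by
          exact neg_le_neg (by exact_mod_cast e2)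
        exact this.trans h.1
    · exact ⟨fun _ => 0, fun h => absurd h hm⟩
  choose J hJ using key
  have hlin : ∀ δ' : Fin 8 → ℝ, (∀ k l : Fin 28, phiForm δ' k / h28 a k < phiForm δ' l / h28 a l →
      phiForm δ₀ k / h28 a k < phiForm δ₀ l / h28 a l) →
      cuspSlope a T δ' = ∑ k, ((∑ m ∈ Finset.range ((bkpts a T).card - 1), J m k : ℤ) : ℝ) *
        (phiForm δ' k / h28 a k) := by
    intro δ' href'
    obtain ⟨ρ, hρ, h1, h2, hgap⟩ := exists_admissible_scale hpos hT δ'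
    rw [cuspSlope_eq_sum_germ_pairs hpos hT hper δ' hρ h1 h2 hgap,
      Finset.sum_congr rfl fun m hm => (hJ m (by have := Finset.mem_range.mp hm; omega)).2 δ' href' ρ hρ h1 h2,
      Finset.sum_comm]
    refine Finset.sum_congr rfl fun k _ => ?_
    rw [Int.cast_sum, Finset.sum_mul]
  -- the count of member junctions bounds the summed weights
  have hcount : ∀ k : Fin 28, (∑ m ∈ Finset.range ((bkpts a T).card - 1),
      (if (∃ z : ℤ, bkpt a T m * h28 a k = z) then (1 : ℝ) else 0)) = T * h28 a k := fun k => by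
    rw [Finset.sum_boole, card_member_junctions hpos hT k (hper k)]
  refine ⟨δ₀, hgen, href, fun k => ∑ m ∈ Finset.range ((bkpts a T).card - 1), J m k, ?_,
    fun k hk => ⟨?_, ?_⟩, fun k hk => ⟨?_, ?_⟩, hlin, hlin δ href⟩
  · -- `Σ 𝒥 = 0`: evaluate at the orbit direction
    have h := hlin ((1 : ℝ) • sParam a) (refines_sParam hpos δ₀ 1)
    rw [cuspSlope_smul_sParam hpos hT hper 1] at h
    simp only [phiForm_smul_sParam, one_mul] at h
    rw [Finset.sum_congr rfl fun k _ => by rw [div_self (hpos k).ne', mul_one]] at h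
    exact_mod_cast h.symm
  · exact Finset.sum_nonneg fun m hm => ((hJ m (by have := Finset.mem_range.mp hm; omega)).1 k).2.1 hk |>.1
  · rw [← hcount k, Int.cast_sum]
    refine Finset.sum_le_sum fun m hm => ?_
    have hm' : m + 1 < (bkpts a T).card := by have := Finset.mem_range.mp hm; omega
    obtain ⟨hsupp, hF, -⟩ := (hJ m hm').1 k
    split_ifs with hmem
    · exact_mod_cast (hF hk).2
    · push Not at hmem
      rw [hsupp hmem]; simp
  · rw [← hcount k, Int.cast_sum, ← Finset.sum_neg_distrib]
    refine Finset.sum_le_sum fun m hm => ?_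
    have hm' : m + 1 < (bkpts a T).card := by have := Finset.mem_range.mp hm; omega
    obtain ⟨hsupp, -, hFc⟩ := (hJ m hm').1 k
    split_ifs with hmem
    · exact_mod_cast (hFc hk).1
    · push Not at hmem
      rw [hsupp hmem]; simp
  · exact Finset.sum_nonpos fun m hm => ((hJ m (by have := Finset.mem_range.mp hm; omega)).1 k).2.2 hk |>.2

/-- The instance at `δ`: bounded oriented weights with `σ(δ) = Σ_k 𝒥_k φ_k(δ)/h_k(a)`. -/
theorem cuspSlope_eq_intLinear_bounded_self {a : Dir} (hpos : ∀ k, 0 < h28 a k) {T : ℝ} (hT : 0 < T)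
    (hper : ∀ k : Fin 28, ∃ z : ℤ, T * h28 a k = z) (δ : Fin 8 → ℝ) :
    ∃ 𝒥 : Fin 28 → ℤ, ∑ k, 𝒥 k = 0 ∧
      (∀ k, k ∈ FIdx → 0 ≤ 𝒥 k ∧ (𝒥 k : ℝ) ≤ T * h28 a k) ∧
      (∀ k, k ∉ FIdx → -(T * h28 a k) ≤ (𝒥 k : ℝ) ∧ 𝒥 k ≤ 0) ∧
      cuspSlope a T δ = ∑ k, (𝒥 k : ℝ) * (phiForm δ k / h28 a k) := by
  obtain ⟨-, -, -, 𝒥, h0, hF, hFc, -, hδ⟩ := cuspSlope_eq_intLinear_bounded hpos hT hper δ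
  exact ⟨𝒥, h0, hF, hFc, hδ⟩

/-! ### The oriented first-order bound -/

/-- One favourable term: `0 ≤ J ≤ T·h` gives `J·(φ/h) ≤ T·φ⁺`. -/
theorem weight_mul_rate_le {J Tn h φ : ℝ} (hh : 0 < h) (hJ0 : 0 ≤ J) (hJ : J ≤ Tn * h) :
    J * (φ / h) ≤ Tn * max φ 0 := by
  calc J * (φ / h) ≤ J * (max φ 0 / h) :=
        mul_le_mul_of_nonneg_left (div_le_div_of_nonneg_right (le_max_left _ _) hh.le) hJ0
    _ ≤ (Tn * h) * (max φ 0 / h) := mul_le_mul_of_nonneg_right hJ (div_nonneg (le_max_right _ _) hh.le)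
    _ = Tn * max φ 0 := by field_simp

/-- One unfavourable term: `−T·h ≤ J ≤ 0` gives `J·(φ/h) ≤ T·φ⁻`. -/
theorem weight_mul_rate_le' {J Tn h φ : ℝ} (hh : 0 < h) (hJ0 : J ≤ 0) (hJ : -(Tn * h) ≤ J) :
    J * (φ / h) ≤ Tn * max (-φ) 0 := by
  have := weight_mul_rate_le (J := -J) (Tn := Tn) (φ := -φ) hh (by linarith) (by linarith)
  calc J * (φ / h) = -J * (-φ / h) := by ring
    _ ≤ Tn * max (-φ) 0 := this

/-- **THE ORIENTED FIRST-ORDER BOUND (upper).** For all 28 forms of `a` positive, `T > 0` a period and every `δ`: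
`cuspSlope a T δ ≤ T·(Σ_{k∈F} φ_k(δ)⁺ + Σ_{k∉F} φ_k(δ)⁻)` — to first order only `F`-forms moving UP and `F^c`-forms
moving DOWN can raise the saving. -/
theorem cuspSlope_le_oriented {a : Dir} (hpos : ∀ k, 0 < h28 a k) {T : ℝ} (hT : 0 < T)
    (hper : ∀ k : Fin 28, ∃ z : ℤ, T * h28 a k = z) (δ : Fin 8 → ℝ) :
    cuspSlope a T δ ≤
      T * (∑ k ∈ FIdx, max (phiForm δ k) 0 + ∑ k ∈ FIdxᶜ, max (-phiForm δ k) 0) := by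
  obtain ⟨𝒥, -, hF, hFc, hδ⟩ := cuspSlope_eq_intLinear_bounded_self hpos hT hper δ
  rw [hδ, ← Finset.sum_add_sum_compl FIdx, mul_add, Finset.mul_sum, Finset.mul_sum]
  refine add_le_add (Finset.sum_le_sum fun k hk => ?_) (Finset.sum_le_sum fun k hk => ?_)
  · exact weight_mul_rate_le (hpos k) (by exact_mod_cast (hF k hk).1) (hF k hk).2
  · have hk' : k ∉ FIdx := Finset.mem_compl.mp hk
    exact weight_mul_rate_le' (hpos k) (by exact_mod_cast (hFc k hk').2) (hFc k hk').1

/-- **THE ORIENTED FIRST-ORDER BOUND (lower)**: `−T·(Σ_{k∈F} φ_k(δ)⁻ + Σ_{k∉F} φ_k(δ)⁺) ≤ cuspSlope a T δ`. -/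
theorem oriented_le_cuspSlope {a : Dir} (hpos : ∀ k, 0 < h28 a k) {T : ℝ} (hT : 0 < T)
    (hper : ∀ k : Fin 28, ∃ z : ℤ, T * h28 a k = z) (δ : Fin 8 → ℝ) :
    -(T * (∑ k ∈ FIdx, max (-phiForm δ k) 0 + ∑ k ∈ FIdxᶜ, max (phiForm δ k) 0)) ≤
      cuspSlope a T δ := by
  obtain ⟨𝒥, -, hF, hFc, hδ⟩ := cuspSlope_eq_intLinear_bounded_self hpos hT hper δ
  rw [hδ, ← Finset.sum_add_sum_compl FIdx]
  have h1 : -(T * ∑ k ∈ FIdx, max (-phiForm δ k) 0) ≤ ∑ k ∈ FIdx, (𝒥 k : ℝ) * (phiForm δ k / h28 a k) := by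
    rw [Finset.mul_sum, ← Finset.sum_neg_distrib]
    refine Finset.sum_le_sum fun k hk => neg_le.mp ?_
    have h := weight_mul_rate_le (φ := -phiForm δ k) (hpos k) (by exact_mod_cast (hF k hk).1) (hF k hk).2
    calc -((𝒥 k : ℝ) * (phiForm δ k / h28 a k)) = (𝒥 k : ℝ) * (-phiForm δ k / h28 a k) := by ring
      _ ≤ T * max (-phiForm δ k) 0 := h
  have h2 : -(T * ∑ k ∈ FIdxᶜ, max (phiForm δ k) 0) ≤ ∑ k ∈ FIdxᶜ, (𝒥 k : ℝ) * (phiForm δ k / h28 a k) := by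
    rw [Finset.mul_sum, ← Finset.sum_neg_distrib]
    refine Finset.sum_le_sum fun k hk => neg_le.mp ?_
    have hk' : k ∉ FIdx := Finset.mem_compl.mp hk
    have h := weight_mul_rate_le' (φ := -phiForm δ k) (hpos k) (by exact_mod_cast (hFc k hk').2) (hFc k hk').1
    rw [neg_neg] at h
    calc -((𝒥 k : ℝ) * (phiForm δ k / h28 a k)) = (𝒥 k : ℝ) * (-phiForm δ k / h28 a k) := by ring
      _ ≤ T * max (phiForm δ k) 0 := h
  linarith

end Summit.KontsevichZagierPeriods.Zeta5Search.Barrier.ConeGamma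

end
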